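import Literature.MathematicalPhysics.KineticTheory.CellChainLangevin
import HarnessLib

/-!
# Gibbs weights `e^{cH}` of site-inhomogeneous chains: momentum reversal, integrability, currents

Topic `Literature/MathematicalPhysics/KineticTheory`, grouping namespace `…KineticTheory.HeatConduction`.
Elementary Lebesgue-measure facts about the Boltzmann–Gibbs weights `e^{cH}` (`c < 0`) of the
site-dependent chains `SiteChain` of `CellChain.lean` (Bonetto–Lebowitz–Rey-Bellet 2000 §4.1;
Cuneo–Eckmann–Hairer–Rey-Bellet 2018 §3.1), the layer of the linear-response theory of the
prefix/cell chains that does not involve the dynamics: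

* `SiteChain.hamiltonian_momentumReversal`, `bondCurrent_momentumReversal`,
  `integral_exp_mul_hamiltonian_mul_eq_zero_of_odd`, `integral_exp_mul_hamiltonian_mul_sum_bondCurrent`
  — the energy is even and the currents are odd under `(q, p) ↦ (q, -p)`, which preserves
  Lebesgue measure, so **odd observables have zero Gibbs weight** (no current at equilibrium);
* `SiteChain.UniformlyConfining.integrable_momentSq_mul_exp_mul_hamiltonian` —
  `(1 + p_0² + p_{N-1}²) e^{cH} ∈ L¹(dx)` once `e^{(c/2)H} ∈ L¹(dx)`;
* `SiteChain.UniformlyConfining.continuous_bondCurrent`, `abs_bondCurrent_le_sq`,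
  `exists_abs_sum_bondCurrent_le_exp` — the currents are continuous, `|j_i| ≤ N(B/2)(1+H)²`
  (`B` the force constant of the bonds) and `|∑_i j_i| ≤ M e^{ϑH}` for every `ϑ > 0`;
* `cellChain_hamiltonian_mono_false`, `cellChain_integrable_exp_mul_hamiltonian` — for the cell
  chains (`ω₂ > 0`, `lam, β ≥ 0`) the energy dominates that of the harmonic host, so `e^{cH}` is
  Lebesgue integrable for every `c < 0` (finite partition function at every temperature).

## References

* F. Bonetto, J. L. Lebowitz, L. Rey-Bellet, *Fourier's law: a challenge to theorists* (2000),
  §4.1, §5.2.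
* N. Cuneo, J.-P. Eckmann, M. Hairer, L. Rey-Bellet, Electron. J. Probab. **23** (2018) no. 55, §3.1.

## Design choices

* No Gibbs MEASURE is introduced: downstream (the exact response identity) only the weight
  `e^{-H/T} dx` and `Z = ∫ e^{-H/T} dx > 0` are used.
* NOT here: kernels, semigroups, steady states.
-/

noncomputable section

open MeasureTheory Filter Topology Set
open scoped ContDiff NNReal

namespace Literature.MathematicalPhysics.KineticTheory.HeatConduction

open Literature.MathematicalPhysics.KineticTheory

variable {N : ℕ}

namespace SiteChain

variable (P : SiteChain)

/-! ### Momentum reversal -/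

/-- The energy of a site-dependent chain is even in the momenta. [folklore] -/
theorem hamiltonian_momentumReversal (N : ℕ) (x : PhaseSpace N) :
    P.hamiltonian N (momentumReversal N x) = P.hamiltonian N x := by
  simp [SiteChain.hamiltonian]

/-- The bond currents of a site-dependent chain are odd in the momenta. [folklore] -/
theorem bondCurrent_momentumReversal (N : ℕ) (i : Fin N) (x : PhaseSpace N) :
    P.bondCurrent N i (momentumReversal N x) = -P.bondCurrent N i x := by
  simp only [SiteChain.bondCurrent, momentumReversal_apply, Pi.neg_apply, ← Finset.sum_neg_distrib]
  refine Finset.sum_congr rfl fun j _ => ?_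
  split_ifs
  · ring
  · simp

/-- **Odd observables have zero Gibbs weight**: if `g(q,-p) = -g(q,p)` then `∫ e^{cH} g dq dp = 0`
(momentum reversal preserves Lebesgue measure and `H`; no integrability needed, both sides being the
same Bochner integral). [cite: BonettoLebowitzReyBellet2000, §5.2] -/
theorem integral_exp_mul_hamiltonian_mul_eq_zero_of_odd (N : ℕ) (c : ℝ) {g : PhaseSpace N → ℝ}
    (hg : ∀ x, g (momentumReversal N x) = -g x) :
    ∫ x, Real.exp (c * P.hamiltonian N x) * g x = 0 := by
  have h := integral_comp_momentumReversal N fun x => Real.exp (c * P.hamiltonian N x) * g x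
  have h' : ∀ x : PhaseSpace N, Real.exp (c * P.hamiltonian N (x.1, -x.2)) * g (x.1, -x.2) =
      -(Real.exp (c * P.hamiltonian N x) * g x) := fun x => by
    have h1 := P.hamiltonian_momentumReversal N x
    have h2 := hg x
    rw [momentumReversal_apply] at h1 h2
    rw [h1, h2, mul_neg]
  simp only [h', integral_neg] at h
  linarith

/-- **No current at equilibrium**: `∫ e^{cH} (∑_i j_i) dq dp = 0` for every site-dependent chain.
[cite: BonettoLebowitzReyBellet2000, §5.2] -/
theorem integral_exp_mul_hamiltonian_mul_sum_bondCurrent (N : ℕ) (c : ℝ) :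
    ∫ x, Real.exp (c * P.hamiltonian N x) * ∑ i : Fin N, P.bondCurrent N i x = 0 := by
  refine P.integral_exp_mul_hamiltonian_mul_eq_zero_of_odd N c fun x => ?_
  rw [← Finset.sum_neg_distrib]
  exact Finset.sum_congr rfl fun i _ => P.bondCurrent_momentumReversal N i x

/-! ### Integrability of polynomially weighted Gibbs weights; the currents -/

namespace UniformlyConfining

variable {P} (hP : P.UniformlyConfining)
include hP

/-- `(1 + p_0² + p_{N-1}²) e^{cH}` is Lebesgue-integrable once `e^{(c/2)H}` is (`c < 0`, `N ≥ 1`):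
`p_0² + p_{N-1}² ≤ 4H ≤ (8/(-c)) e^{(-c/2)H}`. [folklore] -/
theorem integrable_momentSq_mul_exp_mul_hamiltonian (hN : 0 < N) {c : ℝ} (hc : c < 0)
    (hint : Integrable fun x : PhaseSpace N => Real.exp (c / 2 * P.hamiltonian N x)) :
    Integrable fun x : PhaseSpace N =>
      (1 + x.2 ⟨0, hN⟩ ^ 2 + x.2 ⟨N - 1, by omega⟩ ^ 2) * Real.exp (c * P.hamiltonian N x) := by
  set Hm := P.hamiltonian N with hHm
  have hHc : Continuous Hm := hP.contDiff_hamiltonian N |>.continuous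
  have hmeas : Continuous fun x : PhaseSpace N =>
      (1 + x.2 ⟨0, hN⟩ ^ 2 + x.2 ⟨N - 1, by omega⟩ ^ 2) * Real.exp (c * Hm x) := by
    refine Continuous.mul ?_ (Real.continuous_exp.comp (continuous_const.mul hHc))
    exact (continuous_const.add (((continuous_apply _).comp continuous_snd).pow 2)).add
      (((continuous_apply _).comp continuous_snd).pow 2)
  refine (hint.const_mul (1 + 4 * (2 / -c))).mono' hmeas.aestronglyMeasurable
    (Eventually.of_forall fun x => ?_)
  have hH0 : 0 ≤ Hm x := hP.hamiltonian_nonneg N x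
  have hkin : ∑ i, x.2 i ^ 2 / 2 ≤ Hm x := P.kinetic_le_hamiltonian_of_nonneg hP.U_nonneg hP.V_nonneg N x
  have hp0 : x.2 ⟨0, hN⟩ ^ 2 / 2 ≤ ∑ i, x.2 i ^ 2 / 2 :=
    Finset.single_le_sum (f := fun i => x.2 i ^ 2 / 2) (fun i _ => by positivity) (Finset.mem_univ _)
  have hpl : x.2 ⟨N - 1, by omega⟩ ^ 2 / 2 ≤ ∑ i, x.2 i ^ 2 / 2 :=
    Finset.single_le_sum (f := fun i => x.2 i ^ 2 / 2) (fun i _ => by positivity) (Finset.mem_univ _)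
  have hHexp : (-c / 2) * Hm x ≤ Real.exp ((-c / 2) * Hm x) := by
    have := Real.add_one_le_exp ((-c / 2) * Hm x)
    linarith
  have hHle : Hm x ≤ (2 / -c) * Real.exp ((-c / 2) * Hm x) := by
    rw [div_mul_eq_mul_div, le_div_iff₀ (by linarith : (0:ℝ) < -c)]
    nlinarith
  have hsum : 1 + x.2 ⟨0, hN⟩ ^ 2 + x.2 ⟨N - 1, by omega⟩ ^ 2 ≤
      1 + 4 * (2 / -c) * Real.exp ((-c / 2) * Hm x) := by linarith
  have hE : 0 < Real.exp (c * Hm x) := Real.exp_pos _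
  have hE1 : 1 ≤ Real.exp ((-c / 2) * Hm x) := Real.one_le_exp (by nlinarith)
  rw [Real.norm_eq_abs, abs_of_nonneg (by positivity)]
  calc (1 + x.2 ⟨0, hN⟩ ^ 2 + x.2 ⟨N - 1, by omega⟩ ^ 2) * Real.exp (c * Hm x)
      ≤ (1 + 4 * (2 / -c) * Real.exp ((-c / 2) * Hm x)) * Real.exp (c * Hm x) :=
        mul_le_mul_of_nonneg_right hsum hE.le
    _ ≤ ((1 + 4 * (2 / -c)) * Real.exp ((-c / 2) * Hm x)) * Real.exp (c * Hm x) := by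
        refine mul_le_mul_of_nonneg_right ?_ hE.le
        have h22 : 0 ≤ 4 * (2 / -c) := by
          have := div_pos (by norm_num : (0:ℝ) < 2) (by linarith : (0:ℝ) < -c)
          linarith
        nlinarith
    _ = (1 + 4 * (2 / -c)) * Real.exp (c / 2 * Hm x) := by
        rw [mul_assoc, ← Real.exp_add]
        congr 1
        ring_nf

/-- The bond currents of a uniformly confining chain are continuous. [folklore] -/
theorem continuous_bondCurrent (N : ℕ) (i : Fin N) : Continuous (P.bondCurrent N i) := by
  have hV' : ∀ k, Continuous (deriv (P.V k)) := fun k => (hP.contDiff_V k).continuous_deriv (by norm_num)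
  unfold SiteChain.bondCurrent
  refine continuous_finsetSum _ fun j _ => ?_
  by_cases h : j.val = i.val + 1
  · simp only [h, if_true]
    exact ((((continuous_apply i).comp continuous_snd).add ((continuous_apply j).comp continuous_snd)).div_const
      _ |>.mul ((hV' _).comp (((continuous_apply j).comp continuous_fst).sub
        ((continuous_apply i).comp continuous_fst)))).neg
  · simp only [h, if_false]
    exact continuous_const

/-- **Polynomial bound on the currents**: `|j_i| ≤ N (B/2) (1 + H)²`, `B` the force constant of the
bonds (`|V_k'| ≤ B(1 + V_k)`). [folklore] -/
theorem abs_bondCurrent_le_sq (N : ℕ) (i : Fin N) (x : PhaseSpace N) :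
    |P.bondCurrent N i x| ≤ N * (hP.forceConstV / 2 * (1 + P.hamiltonian N x) ^ 2) := by
  obtain ⟨hB0, hB⟩ := hP.forceConstV_spec
  set B := hP.forceConstV
  set E : ℝ := P.hamiltonian N x
  have hH0 : 0 ≤ E := hP.hamiltonian_nonneg N x
  have hkin : ∑ k, x.2 k ^ 2 / 2 ≤ E := P.kinetic_le_hamiltonian_of_nonneg hP.U_nonneg hP.V_nonneg N x
  unfold SiteChain.bondCurrent
  have hterm : ∀ j : Fin N, |(if j.val = i.val + 1 then
      -((x.2 i + x.2 j) / 2 * deriv (P.V i.val) (x.1 j - x.1 i)) else 0)| ≤ B / 2 * (1 + E) ^ 2 := by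
    intro j
    split_ifs with hj
    · have hij : i ≠ j := by
        rintro rfl
        omega
      rw [abs_neg, abs_mul, abs_div, abs_two]
      have h2 : x.2 i ^ 2 / 2 + x.2 j ^ 2 / 2 ≤ E := by
        have h1 : x.2 i ^ 2 / 2 + x.2 j ^ 2 / 2 ≤ ∑ k, x.2 k ^ 2 / 2 := by
          rw [← Finset.sum_pair (f := fun k => x.2 k ^ 2 / 2) hij]
          exact Finset.sum_le_sum_of_subset_of_nonneg (Finset.subset_univ _) (fun k _ _ => by positivity)
        linarith
      have hp := abs_add_le_one_add h2
      have hv : |deriv (P.V i.val) (x.1 j - x.1 i)| ≤ B * (1 + E) :=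
        (hB _ _).trans (mul_le_mul_of_nonneg_left
          (by linarith [P.bond_le_hamiltonian hP.U_nonneg hP.V_nonneg N x hj]) hB0)
      calc |x.2 i + x.2 j| / 2 * |deriv (P.V i.val) (x.1 j - x.1 i)|
          ≤ (1 + E) / 2 * (B * (1 + E)) := mul_le_mul (by linarith) hv (abs_nonneg _) (by positivity)
        _ = B / 2 * (1 + E) ^ 2 := by ring
    · rw [abs_zero]; positivity
  calc |∑ j : Fin N, (if j.val = i.val + 1 then -((x.2 i + x.2 j) / 2 * deriv (P.V i.val) (x.1 j - x.1 i))
        else 0)|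
      ≤ ∑ j : Fin N, |(if j.val = i.val + 1 then -((x.2 i + x.2 j) / 2 * deriv (P.V i.val) (x.1 j - x.1 i))
        else 0)| := Finset.abs_sum_le_sum_abs _ _
    _ ≤ ∑ _j : Fin N, B / 2 * (1 + E) ^ 2 := Finset.sum_le_sum fun j _ => hterm j
    _ = N * (B / 2 * (1 + E) ^ 2) := by simp [Finset.sum_const, Finset.card_univ, Fintype.card_fin]

/-- **The total current is an observable of exponential class**: for every `ϑ > 0` there is
`M ≥ 0` with `|∑_i j_i| ≤ M e^{ϑH}`. [folklore] -/
theorem exists_abs_sum_bondCurrent_le_exp (N : ℕ) {ϑ : ℝ} (hϑ : 0 < ϑ) :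
    ∃ M : ℝ, 0 ≤ M ∧ ∀ y : PhaseSpace N,
      |∑ i : Fin N, P.bondCurrent N i y| ≤ M * Real.exp (ϑ * P.hamiltonian N y) := by
  have hB0 := hP.forceConstV_spec.1
  refine ⟨N * (N * (hP.forceConstV / 2) * (2 * Real.exp ϑ / ϑ ^ 2)), by positivity, fun y => ?_⟩
  have hH0 := hP.hamiltonian_nonneg N y
  have hsq := one_add_sq_le_exp hH0 hϑ
  calc |∑ i : Fin N, P.bondCurrent N i y| ≤ ∑ i : Fin N, |P.bondCurrent N i y| := Finset.abs_sum_le_sum_abs _ _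
    _ ≤ ∑ _i : Fin N, (N * (hP.forceConstV / 2) * (2 * Real.exp ϑ / ϑ ^ 2)) *
          Real.exp (ϑ * P.hamiltonian N y) :=
        Finset.sum_le_sum fun i _ => by
          calc |P.bondCurrent N i y| ≤ N * (hP.forceConstV / 2 * (1 + P.hamiltonian N y) ^ 2) :=
                hP.abs_bondCurrent_le_sq N i y
            _ = N * (hP.forceConstV / 2) * (1 + P.hamiltonian N y) ^ 2 := by ring
            _ ≤ N * (hP.forceConstV / 2) * (2 * Real.exp ϑ / ϑ ^ 2 * Real.exp (ϑ * P.hamiltonian N y)) :=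
                mul_le_mul_of_nonneg_left hsq (by positivity)
            _ = _ := by ring
    _ = _ := by rw [Finset.sum_const, Finset.card_univ, Fintype.card_fin, nsmul_eq_mul]; ring

end UniformlyConfining

end SiteChain

/-! ### The cell chains: finite partition function -/

section CellChain

variable {ω₂ lam β : ℝ}

/-- Switching cells on increases the energy: the cell chain with indicator `c` dominates the
harmonic host (`lam, β ≥ 0`). [folklore] -/
theorem cellChain_hamiltonian_mono_false (hl : 0 ≤ lam) (hβ : 0 ≤ β) (γ : ℝ) (c : ℕ → Bool) (N : ℕ)
    (x : PhaseSpace N) :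
    (cellChain ω₂ lam β γ (fun _ => false)).hamiltonian N x ≤ (cellChain ω₂ lam β γ c).hamiltonian N x := by
  unfold SiteChain.hamiltonian
  refine add_le_add (Finset.sum_le_sum fun i _ => add_le_add le_rfl ?_)
    (Finset.sum_le_sum fun i _ => Finset.sum_le_sum fun j _ => ?_)
  · show ω₂ * x.1 i ^ 2 / 2 + (if false then lam else 0) * x.1 i ^ 4 / 4 ≤
      ω₂ * x.1 i ^ 2 / 2 + (if c i.val then lam else 0) * x.1 i ^ 4 / 4
    obtain ⟨h0, -⟩ := ite_amplitude_mem_Icc hl (c i.val)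
    have : (0:ℝ) ≤ x.1 i ^ 4 := by positivity
    simp only [Bool.false_eq_true, if_false, zero_mul, zero_div, add_zero]
    nlinarith
  · split_ifs with h
    · show (x.1 j - x.1 i) ^ 2 / 2 + (if false then β else 0) * (x.1 j - x.1 i) ^ 4 / 4 ≤
        (x.1 j - x.1 i) ^ 2 / 2 + (if c i.val then β else 0) * (x.1 j - x.1 i) ^ 4 / 4
      obtain ⟨h0, -⟩ := ite_amplitude_mem_Icc hβ (c i.val)
      have : (0:ℝ) ≤ (x.1 j - x.1 i) ^ 4 := by positivity
      simp only [Bool.false_eq_true, if_false, zero_mul, zero_div, add_zero]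
      nlinarith
    · exact le_rfl

/-- **Finite partition function of the cell chains at every temperature**: `e^{aH}` is Lebesgue
integrable on phase space for every `a < 0` (`ω₂ > 0`, `lam, β ≥ 0`; domination by the Gaussian
weight of the harmonic host `pinnedChain ω₂ 0 0 γ`). [folklore] -/
theorem cellChain_integrable_exp_mul_hamiltonian (hω : 0 < ω₂) (hl : 0 ≤ lam) (hβ : 0 ≤ β) (γ : ℝ)
    (c : ℕ → Bool) (N : ℕ) {a : ℝ} (ha : a < 0) :
    Integrable fun x : PhaseSpace N => Real.exp (a * (cellChain ω₂ lam β γ c).hamiltonian N x) := by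
  have h0 := pinnedChain_integrable_exp_neg_mul_hamiltonian hω le_rfl le_rfl γ N (c := -a) (by linarith)
  -- the energy does not depend on `γ`; continuity from the `γ = 0` instance of `UniformlyConfining`
  have hHc : Continuous ((cellChain ω₂ lam β γ c).hamiltonian N) :=
    ((cellChain_uniformlyConfining hω hl hβ le_rfl c).contDiff_hamiltonian N).continuous
  refine h0.mono' (Real.continuous_exp.comp (continuous_const.mul hHc)).aestronglyMeasurable
    (Eventually.of_forall fun x => ?_)
  rw [Real.norm_eq_abs, abs_of_pos (Real.exp_pos _)]
  refine Real.exp_le_exp.2 ?_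
  have hle := cellChain_hamiltonian_mono_false (ω₂ := ω₂) hl hβ γ c N x
  have e : (pinnedChain ω₂ 0 0 γ).hamiltonian N x = (cellChain ω₂ lam β γ (fun _ => false)).hamiltonian N x := by
    rw [cellChain_const_false]; rfl
  rw [neg_mul, neg_neg, e]
  nlinarith

end CellChain

end Literature.MathematicalPhysics.KineticTheory.HeatConduction
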